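import Mathlib
import HarnessLib
import Literature.MathematicalPhysics.QuantumLattice.HubbardTorusChemicalPotentialWindow
import Summits.HubbardSuperconductivity.HubbardSuperconductivity.Theorems.ThermalWedgeTwPureThermalBoundReduction

/-!
# Route `ThermalWedge`, item `stmt-HubbardSuperconductivity-1702` (`TwPureThermalBound`):
# the chemical potential of the canonical supporting line lies in the uniform window

Support file (`--supports stmt-HubbardSuperconductivity-1702`; no definition). If `μ` satisfies the
`T = 0` ground-state ensemble-equivalence inequality (GSEE) of the Hubbard torus at density
`n ∈ [3/5, 9/10]` — `E_L(N_L) − μN_L ≤ E_L(K) − μK + εL²` for all `K ≤ 2L²`, eventually in `L`, for every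
`ε > 0`, with `|N_L − nL²| ≤ 2` — then the grand-canonical ground energy `E₀(K^U_{μ'}) = min_K (E_L(K) − μ'K)`
(`stub_gcGroundEnergyEqMin`) satisfies the two approximate supergradient inequalities of
`chemicalPotential_mem_window_of_forall` (seat 2's `HubbardTorusChemicalPotentialWindow.lean`) at the band-edge
test points `μ_hi = −cos²(49π/100)`, `μ_lo = −15/4`, whence `−15/4 − 10U ≤ μ ≤ −cos²(49π/100) + 20U`
(`ptb_window_of_gsee`). Folklore (Ruelle 1969 §3.4).
-/

set_option linter.dupNamespace false

noncomputable section

namespace Summit.HubbardSuperconductivity.HubbardSuperconductivity.Theorems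

open Literature.MathematicalPhysics.QuantumLattice Literature.Probability.LatticeModels Matrix Finset Real
open scoped ComplexOrder BigOperators

/-- `|FermionTorus 2 L| = L²`. [folklore] -/
theorem ptb_card_fermionTorus_two_eq (L : ℕ) : Fintype.card (FermionTorus 2 L) = L ^ 2 := by
  simp [FermionTorus, Fintype.card_lex]

/-- **The grand-canonical ground energy is below every sector**: `E₀(K^U_{μ'}) ≤ E_L(N) − μ'N` for
`N ≤ 2L²`. [folklore] -/
theorem ptb_groundEnergy_le_sector (L : ℕ) (U μ' : ℝ) {N : ℕ} (hN : N ≤ 2 * L ^ 2) :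
    (hubbardTorusWith 2 L 1 U μ').groundEnergy ≤ groundEnergyAt (fermionTorusGraph 2 L) 1 U N - μ' * N := by
  have hT : (hubbardTorusWith 2 L 1 U μ').groundEnergy =
      ⨅ M : Fin (2 * Fintype.card (FermionTorus 2 L) + 1),
        (groundEnergyAt (fermionTorusGraph 2 L) 1 U (M : ℕ) - μ' * ((M : ℕ) : ℝ)) := by
    unfold hubbardTorusWith
    convert stub_gcGroundEnergyEqMin (fermionTorusGraph 2 L) 1 U μ' using 2
  rw [hT]
  have hN' : N < 2 * Fintype.card (FermionTorus 2 L) + 1 := by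
    rw [ptb_card_fermionTorus_two_eq]; omega
  exact ciInf_le (Finite.bddBelow_range _) (⟨N, hN'⟩ : Fin (2 * Fintype.card (FermionTorus 2 L) + 1))

/-- **The approximate supergradient inequality at a test point.** From (GSEE) at `(μ, L, ε)` and
`|N_L − nL²| ≤ 2`: `E₀(K^U_{μ'}) ≤ E₀(K^U_μ) − (μ' − μ)(nL²) + εL² + 2|μ − μ'|`. [folklore] -/
theorem ptb_supergradient_test {L : ℕ} {U n μ μ' ε : ℝ} {NL : ℕ} (hNL : |(NL : ℝ) - n * (L : ℝ) ^ 2| ≤ 2)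
    (hNL2 : NL ≤ 2 * L ^ 2)
    (hG : ∀ K : ℕ, K ≤ 2 * L ^ 2 →
      groundEnergyAt (fermionTorusGraph 2 L) 1 U NL - μ * NL ≤
        groundEnergyAt (fermionTorusGraph 2 L) 1 U K - μ * K + ε * (L : ℝ) ^ 2) :
    (hubbardTorusWith 2 L 1 U μ').groundEnergy ≤
      (hubbardTorusWith 2 L 1 U μ).groundEnergy - (μ' - μ) * (n * (L : ℝ) ^ 2) + ε * (L : ℝ) ^ 2 +
        2 * |μ - μ'| := by
  have h1 := ptb_groundEnergy_le_sector L U μ' hNL2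
  have h2 : groundEnergyAt (fermionTorusGraph 2 L) 1 U NL - μ * NL - ε * (L : ℝ) ^ 2 ≤
      (hubbardTorusWith 2 L 1 U μ).groundEnergy :=
    ptb_le_groundEnergy_of_forall_sector L U μ _ fun N' hN' => by
      have hN2 : N' ≤ 2 * L ^ 2 := by rwa [ptb_card_fermionTorus_two_eq] at hN'
      have := hG N' hN2
      linarith
  have h3 : (μ - μ') * (NL : ℝ) ≤ -(μ' - μ) * (n * (L : ℝ) ^ 2) + 2 * |μ - μ'| := by
    have e1 : (μ - μ') * (NL : ℝ) = -(μ' - μ) * (n * (L : ℝ) ^ 2) + (μ - μ') * ((NL : ℝ) - n * (L : ℝ) ^ 2) := by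
      ring
    rw [e1]
    have h4 : (μ - μ') * ((NL : ℝ) - n * (L : ℝ) ^ 2) ≤ |μ - μ'| * 2 := by
      calc (μ - μ') * ((NL : ℝ) - n * (L : ℝ) ^ 2) ≤ |(μ - μ') * ((NL : ℝ) - n * (L : ℝ) ^ 2)| := le_abs_self _
        _ = |μ - μ'| * |(NL : ℝ) - n * (L : ℝ) ^ 2| := abs_mul _ _
        _ ≤ |μ - μ'| * 2 := mul_le_mul_of_nonneg_left hNL (abs_nonneg _)
    linarith
  have e2 : groundEnergyAt (fermionTorusGraph 2 L) 1 U NL - μ' * NL =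
      (groundEnergyAt (fermionTorusGraph 2 L) 1 U NL - μ * NL) + (μ - μ') * (NL : ℝ) := by ring
  linarith [h1, h2, h3, e2]

/-- **The window from (GSEE).** Let `0 ≤ U`, `n ∈ [3/5, 9/10]`, `|N_L − nL²| ≤ 2`, `N_L ≤ 2L²`, and suppose
`μ` satisfies (GSEE): for every `ε > 0`, eventually in `L`, `E_L(N_L) − μN_L ≤ E_L(K) − μK + εL²` for all
`K ≤ 2L²`. Then `−15/4 − 10U ≤ μ ≤ −cos²(49π/100) + 20U` (`chemicalPotential_mem_window_of_forall`).
[folklore] -/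
theorem ptb_window_of_gsee {U n μ : ℝ} (hU : 0 ≤ U) (hn1 : 3 / 5 ≤ n) (hn2 : n ≤ 9 / 10) {NL : ℕ → ℕ}
    (hNL : ∀ L : ℕ, |(NL L : ℝ) - n * (L : ℝ) ^ 2| ≤ 2) (hNL2 : ∀ L : ℕ, NL L ≤ 2 * L ^ 2)
    (hG : ∀ ε : ℝ, 0 < ε → ∃ L₀ : ℕ, ∀ L : ℕ, L₀ ≤ L → ∀ K : ℕ, K ≤ 2 * L ^ 2 →
      groundEnergyAt (fermionTorusGraph 2 L) 1 U (NL L) - μ * (NL L) ≤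
        groundEnergyAt (fermionTorusGraph 2 L) 1 U K - μ * K + ε * (L : ℝ) ^ 2) :
    -15 / 4 - 10 * U ≤ μ ∧ μ ≤ -Real.cos (49 * π / 100) ^ 2 + 20 * U := by
  refine chemicalPotential_mem_window_of_forall hU hn1 hn2 fun η hη => ?_
  obtain ⟨L₀, hL₀⟩ := hG (η / 2) (by positivity)
  -- `L` large: `L ≥ L₀`, `L ≥ 400`, and `2|μ − μ'| ≤ (η/2)L²` at both test points
  set A : ℝ := 2 * |μ - -Real.cos (49 * π / 100) ^ 2| + 2 * |μ - -15 / 4| with hA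
  have hA0 : 0 ≤ A := by positivity
  obtain ⟨L₁, hL₁⟩ := exists_nat_gt (A / (η / 2))
  set L : ℕ := max (max L₀ 400) (L₁ + 1) with hLdef
  have hLL₀ : L₀ ≤ L := le_trans (le_max_left _ _) (le_max_left _ _)
  have hL400 : 400 ≤ L := le_trans (le_max_right _ _) (le_max_left _ _)
  have hLL₁ : (L₁ : ℝ) + 1 ≤ L := by exact_mod_cast le_max_right _ _
  have hL1 : (1 : ℝ) ≤ L := by linarith [(Nat.cast_nonneg L₁ : (0 : ℝ) ≤ L₁)]
  have hAL : A ≤ η / 2 * (L : ℝ) ^ 2 := by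
    have h1 : A / (η / 2) < L := lt_of_lt_of_le hL₁ (by linarith)
    rw [div_lt_iff₀ (by positivity)] at h1
    have h2 : (L : ℝ) ≤ (L : ℝ) ^ 2 := by nlinarith
    nlinarith [h1, h2, hη]
  refine ⟨L, hL400, ?_, ?_⟩
  · have h := ptb_supergradient_test (μ' := -Real.cos (49 * π / 100) ^ 2) (hNL L) (hNL2 L) (hL₀ L hLL₀)
    have hB : 2 * |μ - -Real.cos (49 * π / 100) ^ 2| ≤ A := by rw [hA]; linarith [abs_nonneg (μ - -15 / 4)]
    linarith
  · have h := ptb_supergradient_test (μ' := -15 / 4) (hNL L) (hNL2 L) (hL₀ L hLL₀)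
    have hB : 2 * |μ - -15 / 4| ≤ A := by
      rw [hA]; linarith [abs_nonneg (μ - -Real.cos (49 * π / 100) ^ 2)]
    linarith

end Summit.HubbardSuperconductivity.HubbardSuperconductivity.Theorems

end
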